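import Mathlib.MeasureTheory.Measure.Tilted
import Mathlib.MeasureTheory.Measure.Count
import Mathlib.MeasureTheory.Measure.Dirac
import Mathlib.MeasureTheory.Integral.Bochner.Basic
import Mathlib.Analysis.SpecialFunctions.Exp
import Mathlib.MeasureTheory.Measure.Typeclasses.Probability
import Literature.Probability.LatticeModels.LatticeGraph
import Literature.Probability.LatticeModels.Correlations
import HarnessLib

-- provenance: harness21/H21/H21/Prelude/StatMech/IsingModel.lean @ fddcd03 (interim HEAD d8f2665); M5 mechanical rewrite
/-!
# The finite-volume Ising model with boundary conditions

Trunk G02 (T-STATMECH), prelude item P5 `IsingModel` (notion `ising_finite_volume_gibbs`).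

For a locally finite simple graph `G` on `V`, a finite volume `Λ : Finset V`, inverse temperature
`β`, magnetic field `h` and a boundary condition `bc` (free, or fixed to a configuration `η`
outside `Λ`) we define the finite-volume Ising Gibbs measure `isingMeasure G Λ β h bc` as a
probability measure on the *infinite* configuration space `SpinConfig V = V → ℤˣ`, concentrated
on configurations that agree with `bc.outside` off `Λ` (Friedli–Velenik 2017, §3.1; Georgii 2011,
Ch. 6).

## Design

* `BoundaryCondition V` is `free | fixed η`; `plus`/`minus` are `fixed 1`/`fixed (-1)`.
* `glue Λ τ bc` extends a finite configuration `τ : Λ → ℤˣ` by `bc.outside` (for the free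
  boundary condition the outside is frozen to the junk value `1`; the free Hamiltonian never
  looks outside `Λ`).
* The Hamiltonian is in the Friedli–Velenik form (eq. (3.2)/(3.6)) with a bc-dependent edge set
  `interactionEdges` (`ℰ_Λ` for free, `ℰ_Λ^b` for fixed) and no separate boundary term:
  `H(σ) = -∑_{{x,y}} σ_x σ_y - h ∑_{x ∈ Λ} σ_x`.
* The Gibbs measure is built with Mathlib's `Measure.tilted` (outline D3'): the reference measure
  `isingRef Λ bc` is the push-forward of the counting measure on `Λ → ℤˣ` under `glue`, and
  `isingMeasure = (isingRef Λ bc).tilted (-β H)`. The `IsProbabilityMeasure` instance is a real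
  proof via `isProbabilityMeasure_tilted`.
* The explicit finite-sum picture (`isingWeight`, `isingPartitionFunction`,
  `isingMeasure_apply_singleton`, `integral_isingMeasure` — the latter for *measurable* `f`, since
  for uncountable `V` a non-measurable integrand has Bochner-junk integral `0`) is provided as API.
* Spin-flip symmetry is stated twice: `isingCorr_fixed_flip` (fixed b.c., all `A`) and
  `isingCorr_flip` (any b.c., `A ⊆ Λ`, needed for the free case whose outside is frozen).
* Expectations `isingExpect`, correlations `isingCorr = ⟨σ_A⟩` (set form, for GKS) and the two-point
  function `isingTwoPoint = ⟨σ_x σ_y⟩` (expectation of a product, outline §0).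

## Mathlib status

Mathlib has no Ising model / lattice Gibbs measure. Anchors used verbatim: `Measure.count`,
`Measure.map`, `Measure.tilted`, `isProbabilityMeasure_tilted`, `tilted_apply`, `integral_tilted`,
`Sym2.lift`, `Real.exp`.

## References

* S. Friedli, Y. Velenik, *Statistical Mechanics of Lattice Systems* (CUP 2017), §3.1
  (finite-volume Gibbs distributions, boundary conditions), §3.6–3.7 (correlations, symmetries).
* H.-O. Georgii, *Gibbs Measures and Phase Transitions*, 2nd ed. (de Gruyter 2011), Ch. 6.
-/

noncomputable section

open MeasureTheory Finset

namespace Literature.Probability.LatticeModels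

variable {V : Type*}

/-! ### Boundary conditions and glued configurations -/

/-- A boundary condition for the finite-volume Ising model: `free` (no interaction across the
boundary of `Λ`) or `fixed η` (spins outside `Λ` frozen to the configuration `η`)
(Friedli–Velenik 2017, §3.1). [cite: FriedliVelenik2017, §3.1] -/
inductive BoundaryCondition (V : Type*) where
  /-- Free boundary condition (Friedli–Velenik 2017, §3.1, `μ_{Λ;β,h}^∅`). -/
  | free : BoundaryCondition V
  /-- Boundary condition fixed to `η` outside `Λ` (Friedli–Velenik 2017, §3.1, `μ_{Λ;β,h}^η`). -/
  | fixed (η : SpinConfig V) : BoundaryCondition V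

namespace BoundaryCondition

/-- The `+` boundary condition, all outside spins equal to `1` (Friedli–Velenik 2017, §3.1). [cite: FriedliVelenik2017, §3.1] -/
def plus : BoundaryCondition V := fixed 1

/-- The `-` boundary condition, all outside spins equal to `-1` (Friedli–Velenik 2017, §3.1). [cite: FriedliVelenik2017, §3.1] -/
def minus : BoundaryCondition V := fixed (-1)

/-- The configuration imposed outside `Λ` by a boundary condition: `η` for `fixed η`, and the
junk value `1` (constant configuration) for `free` — the free Hamiltonian never evaluates spins
outside `Λ`, so this junk value is invisible in `Λ`-local observables
(Friedli–Velenik 2017, §3.1). [cite: FriedliVelenik2017, §3.1] -/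
def outside : BoundaryCondition V → SpinConfig V
  | free => 1
  | fixed η => η

/-- The global spin flip of a boundary condition: `free ↦ free`, `fixed η ↦ fixed (-η)`
(Friedli–Velenik 2017, §3.7.1, spin-flip symmetry). [cite: FriedliVelenik2017, §3.7.1  spin-flip symmetry] -/
def flip : BoundaryCondition V → BoundaryCondition V
  | free => free
  | fixed η => fixed (-η)

/-- `outside` of a fixed boundary condition (Friedli–Velenik 2017, §3.1). [cite: FriedliVelenik2017, §3.1] -/
@[simp] theorem outside_fixed (η : SpinConfig V) : (fixed η).outside = η := rfl

/-- `outside` of the free boundary condition is the junk constant `1`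
(Friedli–Velenik 2017, §3.1). [cite: FriedliVelenik2017, §3.1] -/
@[simp] theorem outside_free : (free : BoundaryCondition V).outside = 1 := rfl

/-- `free.flip = free` (Friedli–Velenik 2017, §3.7.1). [cite: FriedliVelenik2017, §3.7.1] -/
@[simp] theorem flip_free : (free : BoundaryCondition V).flip = free := rfl

/-- `(fixed η).flip = fixed (-η)` (Friedli–Velenik 2017, §3.7.1). [cite: FriedliVelenik2017, §3.7.1] -/
@[simp] theorem flip_fixed (η : SpinConfig V) : (fixed η).flip = fixed (-η) := rfl

/-- `plus.flip = minus` (Friedli–Velenik 2017, §3.7.1). [cite: FriedliVelenik2017, §3.7.1] -/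
@[simp] theorem flip_plus : (plus : BoundaryCondition V).flip = minus := rfl

/-- `minus.flip = plus` (Friedli–Velenik 2017, §3.7.1). [cite: FriedliVelenik2017, §3.7.1] -/
@[simp] theorem flip_minus : (minus : BoundaryCondition V).flip = plus := by
  simp [minus, plus, flip]

/-- `flip` is an involution (Friedli–Velenik 2017, §3.7.1). [cite: FriedliVelenik2017, §3.7.1] -/
@[simp] theorem flip_flip (bc : BoundaryCondition V) : bc.flip.flip = bc := by
  cases bc <;> simp [flip]

end BoundaryCondition

/-- Glue a finite configuration `τ : Λ → ℤˣ` inside `Λ` with the boundary condition outside: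
`glue Λ τ bc x = τ x` for `x ∈ Λ` and `= bc.outside x` otherwise
(Friedli–Velenik 2017, §3.1, `Ω_Λ^η`). [cite: FriedliVelenik2017, §3.1   Ω_Λ^η] -/
def glue (Λ : Finset V) (τ : Λ → ℤˣ) (bc : BoundaryCondition V) : SpinConfig V :=
  open Classical in fun x => if hx : x ∈ Λ then τ ⟨x, hx⟩ else bc.outside x

/-- Inside `Λ` the glued configuration is `τ` (Friedli–Velenik 2017, §3.1). [cite: FriedliVelenik2017, §3.1] -/
@[simp] theorem glue_apply_of_mem (Λ : Finset V) (τ : Λ → ℤˣ) (bc : BoundaryCondition V) {x : V}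
    (hx : x ∈ Λ) : glue Λ τ bc x = τ ⟨x, hx⟩ := by
  simp [glue, hx]

/-- Outside `Λ` the glued configuration is `bc.outside` (Friedli–Velenik 2017, §3.1). [cite: FriedliVelenik2017, §3.1] -/
@[simp] theorem glue_apply_of_notMem (Λ : Finset V) (τ : Λ → ℤˣ) (bc : BoundaryCondition V) {x : V}
    (hx : x ∉ Λ) : glue Λ τ bc x = bc.outside x := by
  simp [glue, hx]

/-- `τ ↦ glue Λ τ bc` is measurable: its source `Λ → ℤˣ` is finite and discrete
(Friedli–Velenik 2017, §6.2). [cite: FriedliVelenik2017, §6.2] -/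
@[fun_prop]
theorem measurable_glue (Λ : Finset V) (bc : BoundaryCondition V) :
    Measurable (fun τ : Λ → ℤˣ => glue Λ τ bc) :=
  measurable_of_finite _

/-- `glue` is injective in the finite configuration (Friedli–Velenik 2017, §3.1). [cite: FriedliVelenik2017, §3.1] -/
theorem glue_injective (Λ : Finset V) (bc : BoundaryCondition V) :
    Function.Injective (fun τ : Λ → ℤˣ => glue Λ τ bc) := by
  intro τ τ' h
  funext ⟨x, hx⟩
  have := congrFun h x
  simpa [glue, hx] using this

/-- Global spin flip commutes with gluing for fixed boundary conditions:
`glue Λ (-τ) (fixed (-η)) = -glue Λ τ (fixed η)` (Friedli–Velenik 2017, §3.7.1). [cite: FriedliVelenik2017, §3.7.1] -/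
theorem glue_neg_fixed (Λ : Finset V) (τ : Λ → ℤˣ) (η : SpinConfig V) :
    glue Λ (-τ) (.fixed (-η)) = -glue Λ τ (.fixed η) := by
  funext x
  by_cases hx : x ∈ Λ <;> simp [hx]

/-! ### The Hamiltonian -/

/-- The bond observable `σ_x σ_y` of an unordered pair `e = s(x, y)`, via `Sym2.lift`
(Friedli–Velenik 2017, §3.1). [cite: FriedliVelenik2017, §3.1] -/
def bondSpin (σ : SpinConfig V) : Sym2 V → ℝ :=
  Sym2.lift ⟨fun x y => spinAt x σ * spinAt y σ, fun _ _ => mul_comm _ _⟩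

/-- `bondSpin σ s(x, y) = σ_x σ_y` (Friedli–Velenik 2017, §3.1). [cite: FriedliVelenik2017, §3.1] -/
@[simp] theorem bondSpin_mk (σ : SpinConfig V) (x y : V) :
    bondSpin σ s(x, y) = spinAt x σ * spinAt y σ := rfl

/-- `σ ↦ σ_x σ_y` on a fixed bond is measurable (Friedli–Velenik 2017, §6.2). [cite: FriedliVelenik2017, §6.2] -/
@[fun_prop]
theorem measurable_bondSpin (e : Sym2 V) : Measurable (fun σ : SpinConfig V => bondSpin σ e) := by
  induction e using Sym2.ind with
  | _ x y => exact (measurable_spinAt x).mul (measurable_spinAt y)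

section Hamiltonian

variable (G : SimpleGraph V) [DecidableEq V] [G.LocallyFinite]

/-- The set of interacting edges for the volume `Λ` and boundary condition `bc`: the edges inside
`Λ` (`ℰ_Λ`) for the free boundary condition and the edges touching `Λ` (`ℰ_Λ^b`) for a fixed one
(Friedli–Velenik 2017, §3.1, eqs. (3.2) and (3.6)). [cite: FriedliVelenik2017, §3.1  eqs. (3.2] -/
def interactionEdges (Λ : Finset V) : BoundaryCondition V → Finset (Sym2 V)
  | .free => edgesIn G Λ
  | .fixed _ => edgesTouching G Λ

/-- `interactionEdges` for the free boundary condition (Friedli–Velenik 2017, §3.1). [cite: FriedliVelenik2017, §3.1] -/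
@[simp] theorem interactionEdges_free (Λ : Finset V) :
    interactionEdges G Λ .free = edgesIn G Λ := rfl

/-- `interactionEdges` for a fixed boundary condition (Friedli–Velenik 2017, §3.1). [cite: FriedliVelenik2017, §3.1] -/
@[simp] theorem interactionEdges_fixed (Λ : Finset V) (η : SpinConfig V) :
    interactionEdges G Λ (.fixed η) = edgesTouching G Λ := rfl

/-- The finite-volume Ising Hamiltonian with boundary condition `bc`, in the Friedli–Velenik form
`H_{Λ;h}^{bc}(σ) = -∑_{{x,y} ∈ ℰ^{bc}_Λ} σ_x σ_y - h ∑_{x ∈ Λ} σ_x`; there is no separate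
boundary term, the boundary spins enter through the edges of `ℰ_Λ^b` leaving `Λ`
(Friedli–Velenik 2017, §3.1, eqs. (3.2), (3.6); Georgii 2011, Ch. 6). [cite: FriedliVelenik2017, §3.1  eqs. (3.2] -/
def isingHamiltonian (Λ : Finset V) (h : ℝ) (bc : BoundaryCondition V) (σ : SpinConfig V) : ℝ :=
  -(∑ e ∈ interactionEdges G Λ bc, bondSpin σ e) - h * ∑ x ∈ Λ, spinAt x σ

/-- The Hamiltonian is measurable for the product σ-algebra (Friedli–Velenik 2017, §6.2). [cite: FriedliVelenik2017, §6.2] -/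
@[fun_prop]
theorem measurable_isingHamiltonian (Λ : Finset V) (h : ℝ) (bc : BoundaryCondition V) :
    Measurable (isingHamiltonian G Λ h bc) := by
  unfold isingHamiltonian
  refine Measurable.sub (Finset.measurable_sum _ fun e _ => measurable_bondSpin e).neg ?_
  exact (Finset.measurable_sum _ fun x _ => measurable_spinAt x).const_mul h

end Hamiltonian

/-! ### The finite-volume Gibbs measure -/

section Measure

variable (G : SimpleGraph V) [DecidableEq V] [G.LocallyFinite]

/-- The reference measure of the volume `Λ` with boundary condition `bc`: the counting measure on
finite configurations `Λ → ℤˣ`, pushed forward to `SpinConfig V` by gluing with `bc.outside`. It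
is a finite, nonzero measure concentrated on `{σ | σ = bc.outside off Λ}` (`glue` is measurable,
`measurable_glue`, so `Measure.map` carries no junk here) (Friedli–Velenik 2017, §3.1, `Ω_Λ^η`;
Georgii 2011, Ch. 6). [cite: FriedliVelenik2017, §3.1   Ω_Λ^η] -/
def isingRef (Λ : Finset V) (bc : BoundaryCondition V) : Measure (SpinConfig V) :=
  (Measure.count : Measure (Λ → ℤˣ)).map (fun τ => glue Λ τ bc)

/-- The reference measure is finite (`2^{|Λ|}` atoms) (Friedli–Velenik 2017, §3.1). [cite: FriedliVelenik2017, §3.1] -/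
instance isingRef.instIsFiniteMeasure (Λ : Finset V) (bc : BoundaryCondition V) :
    IsFiniteMeasure (isingRef Λ bc) :=
  Measure.isFiniteMeasure_map _ _

/-- The reference measure is nonzero (the finite configuration space is nonempty)
(Friedli–Velenik 2017, §3.1). [cite: FriedliVelenik2017, §3.1] -/
instance isingRef.instNeZero (Λ : Finset V) (bc : BoundaryCondition V) : NeZero (isingRef Λ bc) :=
  ⟨(Measure.map_ne_zero_iff (measurable_glue Λ bc).aemeasurable).2 (NeZero.ne _)⟩

/-- The finite-volume Ising Gibbs measure `μ_{Λ;β,h}^{bc}` on `SpinConfig V`: the reference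
measure `isingRef Λ bc` tilted by the Boltzmann weight `exp (-β H_{Λ;h}^{bc})` (Mathlib
`Measure.tilted`, which includes the normalisation by the partition function)
(Friedli–Velenik 2017, §3.1, Def. 3.1 and eq. (3.7); Georgii 2011, Ch. 6). [cite: FriedliVelenik2017, §3.1  Def. 3.1 and eq. (3.7] -/
def isingMeasure (Λ : Finset V) (β h : ℝ) (bc : BoundaryCondition V) : Measure (SpinConfig V) :=
  (isingRef Λ bc).tilted fun σ => -β * isingHamiltonian G Λ h bc σ

/-- The Boltzmann factor is integrable against the (finite, discrete-source) reference measure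
(Friedli–Velenik 2017, §3.1). [cite: FriedliVelenik2017, §3.1] -/
theorem integrable_exp_isingHamiltonian (Λ : Finset V) (β h : ℝ) (bc : BoundaryCondition V) :
    Integrable (fun σ => Real.exp (-β * isingHamiltonian G Λ h bc σ)) (isingRef Λ bc) := by
  have hm : Measurable fun σ => Real.exp (-β * isingHamiltonian G Λ h bc σ) :=
    Real.measurable_exp.comp ((measurable_isingHamiltonian G Λ h bc).const_mul _)
  rw [isingRef, integrable_map_measure hm.aestronglyMeasurable (measurable_glue Λ bc).aemeasurable]
  exact Integrable.of_finite

/-- The finite-volume Ising measure is a probability measure; a real proof via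
`isProbabilityMeasure_tilted` (Friedli–Velenik 2017, §3.1). [cite: FriedliVelenik2017, §3.1] -/
instance isingMeasure.instIsProbabilityMeasure (Λ : Finset V) (β h : ℝ) (bc : BoundaryCondition V) :
    IsProbabilityMeasure (isingMeasure G Λ β h bc) :=
  isProbabilityMeasure_tilted (integrable_exp_isingHamiltonian G Λ β h bc)

/-- The Boltzmann weight `w(τ) = exp (-β H_{Λ;h}^{bc}(glue τ))` of a finite configuration
(Friedli–Velenik 2017, §3.1, eq. (3.7)). [cite: FriedliVelenik2017, §3.1  eq. (3.7] -/
def isingWeight (Λ : Finset V) (β h : ℝ) (bc : BoundaryCondition V) (τ : Λ → ℤˣ) : ℝ :=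
  Real.exp (-β * isingHamiltonian G Λ h bc (glue Λ τ bc))

/-- Boltzmann weights are positive (Friedli–Velenik 2017, §3.1). [cite: FriedliVelenik2017, §3.1] -/
theorem isingWeight_pos (Λ : Finset V) (β h : ℝ) (bc : BoundaryCondition V) (τ : Λ → ℤˣ) :
    0 < isingWeight G Λ β h bc τ :=
  Real.exp_pos _

/-- The partition function `Z_{Λ;β,h}^{bc} = ∑_τ exp (-β H(glue τ))`
(Friedli–Velenik 2017, §3.1, eq. (3.4)/(3.7)). [cite: FriedliVelenik2017, §3.1  eq. (3.4] -/
def isingPartitionFunction (Λ : Finset V) (β h : ℝ) (bc : BoundaryCondition V) : ℝ :=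
  ∑ τ : Λ → ℤˣ, isingWeight G Λ β h bc τ

/-- The partition function is positive (Friedli–Velenik 2017, §3.1). [cite: FriedliVelenik2017, §3.1] -/
theorem isingPartitionFunction_pos (Λ : Finset V) (β h : ℝ) (bc : BoundaryCondition V) :
    0 < isingPartitionFunction G Λ β h bc :=
  Finset.sum_pos (fun τ _ => isingWeight_pos G Λ β h bc τ) Finset.univ_nonempty

/-- The normalising integral of `Measure.tilted` is the partition function:
`∫ exp (-β H) ∂(isingRef Λ bc) = Z` (Friedli–Velenik 2017, §3.1). [cite: FriedliVelenik2017, §3.1] -/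
theorem integral_exp_isingRef (Λ : Finset V) (β h : ℝ) (bc : BoundaryCondition V) :
    ∫ σ, Real.exp (-β * isingHamiltonian G Λ h bc σ) ∂isingRef Λ bc =
      isingPartitionFunction G Λ β h bc := by
  have hm : Measurable fun σ => Real.exp (-β * isingHamiltonian G Λ h bc σ) :=
    Real.measurable_exp.comp ((measurable_isingHamiltonian G Λ h bc).const_mul _)
  rw [isingRef, integral_map (measurable_glue Λ bc).aemeasurable hm.aestronglyMeasurable,
    integral_fintype Integrable.of_finite]
  simp [isingPartitionFunction, isingWeight]

/-- The Gibbs probability of a single glued configuration is `w(τ) / Z`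
(Friedli–Velenik 2017, §3.1, Def. 3.1). True for every `V`: when `{glue τ}` is not measurable
(uncountable `V`) the `Λ`-cylinder of `glue τ` is a measurable superset of the same measure; for
`[Countable V]` it follows from `tilted_apply` and `Measure.count`. [cite: FriedliVelenik2017, §3.1  Def. 3.1] -/
def isingMeasure_apply_singleton : Prop :=
  ∀ (Λ : Finset V) (β h : ℝ) (bc : BoundaryCondition V) (τ : Λ → ℤˣ),
    isingMeasure G Λ β h bc {glue Λ τ bc} =
      ENNReal.ofReal (isingWeight G Λ β h bc τ / isingPartitionFunction G Λ β h bc)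

/-- The same in real form: `μ.real {glue τ} = w(τ) / Z` (Friedli–Velenik 2017, §3.1). [cite: FriedliVelenik2017, §3.1] -/
def isingMeasure_real_singleton : Prop :=
  ∀ (Λ : Finset V) (β h : ℝ) (bc : BoundaryCondition V) (τ : Λ → ℤˣ),
    (isingMeasure G Λ β h bc).real {glue Λ τ bc} =
      isingWeight G Λ β h bc τ / isingPartitionFunction G Λ β h bc

/- interim proof relied on results that are now named facts (D-0014); demoted to a fact by the M5 import, proof preserved:
:= by
  rw [Measure.real, isingMeasure_apply_singleton, ENNReal.toReal_ofReal]
  exact div_nonneg (isingWeight_pos G Λ β h bc τ).le (isingPartitionFunction_pos G Λ β h bc).le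
-/

/-- Expectations under the finite-volume Gibbs measure are finite Boltzmann-weighted averages:
`∫ f dμ_{Λ;β,h}^{bc} = (∑_τ w(τ) f(glue τ)) / Z` for measurable `f` (Friedli–Velenik 2017, §3.1,
eq. (3.8); via `integral_tilted` and `integral_map`). The measurability hypothesis is needed: for
uncountable `V` a non-measurable `f` has Bochner-junk integral `0`. [cite: FriedliVelenik2017, §3.1  eq. (3.8] -/
theorem integral_isingMeasure (Λ : Finset V) (β h : ℝ) (bc : BoundaryCondition V)
    {f : SpinConfig V → ℝ} (hf : Measurable f) :
    ∫ σ, f σ ∂isingMeasure G Λ β h bc =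
      (∑ τ : Λ → ℤˣ, isingWeight G Λ β h bc τ * f (glue Λ τ bc)) /
        isingPartitionFunction G Λ β h bc := by
  have hm : Measurable fun σ => Real.exp (-β * isingHamiltonian G Λ h bc σ) :=
    Real.measurable_exp.comp ((measurable_isingHamiltonian G Λ h bc).const_mul _)
  have hm' : Measurable fun σ =>
      (Real.exp (-β * isingHamiltonian G Λ h bc σ) / isingPartitionFunction G Λ β h bc) • f σ :=
    (hm.div_const _).smul hf
  rw [isingMeasure, integral_tilted, integral_exp_isingRef, isingRef,
    integral_map (measurable_glue Λ bc).aemeasurable hm'.aestronglyMeasurable]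
  simp only [smul_eq_mul]
  rw [integral_fintype Integrable.of_finite, Finset.sum_div]
  refine Finset.sum_congr rfl fun τ _ => ?_
  simp only [count_real_singleton, isingWeight]
  ring

/-- The Gibbs measure is concentrated on configurations equal to `bc.outside` off `Λ`
(Friedli–Velenik 2017, §3.1, `μ(Ω_Λ^η) = 1`). [cite: FriedliVelenik2017, §3.1   μ(Ω_Λ^η] -/
def isingMeasure_range_glue : Prop :=
  ∀ (Λ : Finset V) (β h : ℝ) (bc : BoundaryCondition V),
    isingMeasure G Λ β h bc (Set.range fun τ : Λ → ℤˣ => glue Λ τ bc) = 1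

end Measure

/-! ### Expectations and correlation functions -/

section Expect

variable (G : SimpleGraph V) [DecidableEq V] [G.LocallyFinite]

/-- The Gibbs expectation `⟨f⟩_{Λ;β,h}^{bc} = ∫ f dμ_{Λ;β,h}^{bc}`
(Friedli–Velenik 2017, §3.1, eq. (3.8)). For `f` not a.e.-strongly measurable (possible only for
uncountable `V`) the value is the Bochner junk value `0`; see `integral_isingMeasure`. [cite: FriedliVelenik2017, §3.1  eq. (3.8] -/
def isingExpect (Λ : Finset V) (β h : ℝ) (bc : BoundaryCondition V) (f : SpinConfig V → ℝ) : ℝ :=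
  ∫ σ, f σ ∂isingMeasure G Λ β h bc

/-- The set-indexed correlation `⟨σ_A⟩_{Λ;β,h}^{bc}` (Friedli–Velenik 2017, §3.6.1). For the free
boundary condition and `A ⊄ Λ` the value is junk (spins outside `Λ` are frozen to `1`);
statements using it carry the hypothesis `A ⊆ Λ`. Equals `spinCorr (isingMeasure …) A`. [cite: FriedliVelenik2017, §3.6.1] -/
def isingCorr (Λ : Finset V) (β h : ℝ) (bc : BoundaryCondition V) (A : Finset V) : ℝ :=
  isingExpect G Λ β h bc (spinProduct A)

/-- The finite-volume two-point function `⟨σ_x σ_y⟩_{Λ;β,h}^{bc}`, an expectation of a product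
(so `= 1` on the diagonal) (Friedli–Velenik 2017, §3.2). Equals `spinTwoPoint (isingMeasure …)`. [cite: FriedliVelenik2017, §3.2] -/
def isingTwoPoint (Λ : Finset V) (β h : ℝ) (bc : BoundaryCondition V) (x y : V) : ℝ :=
  isingExpect G Λ β h bc (spinPair x y)

/-- `isingCorr` is `spinCorr` of the Gibbs measure (Friedli–Velenik 2017, §3.6.1). [cite: FriedliVelenik2017, §3.6.1] -/
theorem isingCorr_eq_spinCorr (Λ : Finset V) (β h : ℝ) (bc : BoundaryCondition V) (A : Finset V) :
    isingCorr G Λ β h bc A = spinCorr (isingMeasure G Λ β h bc) A := rfl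

/-- `isingTwoPoint` is `spinTwoPoint` of the Gibbs measure (Friedli–Velenik 2017, §3.2). [cite: FriedliVelenik2017, §3.2] -/
theorem isingTwoPoint_eq_spinTwoPoint (Λ : Finset V) (β h : ℝ) (bc : BoundaryCondition V)
    (x y : V) : isingTwoPoint G Λ β h bc x y = spinTwoPoint (isingMeasure G Λ β h bc) x y := rfl

/-- The diagonal of the two-point function is `1` (Friedli–Velenik 2017, §3.2). [cite: FriedliVelenik2017, §3.2] -/
@[simp] theorem isingTwoPoint_self (Λ : Finset V) (β h : ℝ) (bc : BoundaryCondition V) (x : V) :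
    isingTwoPoint G Λ β h bc x x = 1 :=
  spinTwoPoint_self _ x

/-- `|⟨σ_A⟩| ≤ 1` (Friedli–Velenik 2017, §3.6.1). [cite: FriedliVelenik2017, §3.6.1] -/
theorem abs_isingCorr_le_one (Λ : Finset V) (β h : ℝ) (bc : BoundaryCondition V) (A : Finset V) :
    |isingCorr G Λ β h bc A| ≤ 1 :=
  abs_spinCorr_le_one _ A

/-- Spin-flip symmetry: flipping the boundary condition and the sign of the field multiplies
`⟨σ_A⟩` by `(-1)^{|A|}`: `⟨σ_A⟩_{Λ;β,-h}^{-η} = (-1)^{|A|} ⟨σ_A⟩_{Λ;β,h}^{η}`, for every finite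
`A` (the change of variables `τ ↦ -τ` uses `glue_neg_fixed`)
(Friedli–Velenik 2017, §3.7.1 and Exercise 3.4). [cite: FriedliVelenik2017, §3.7.1 and Exercise 3.4] -/
def isingCorr_fixed_flip : Prop :=
  ∀ (Λ : Finset V) (β h : ℝ) (η : SpinConfig V) (A : Finset V),
    isingCorr G Λ β (-h) (.fixed (-η)) A = (-1) ^ #A * isingCorr G Λ β h (.fixed η) A

/-- Spin-flip symmetry for a general boundary condition and `A ⊆ Λ`:
`⟨σ_A⟩_{Λ;β,-h}^{bc.flip} = (-1)^{|A|} ⟨σ_A⟩_{Λ;β,h}^{bc}`. The hypothesis `A ⊆ Λ` is needed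
for `bc = free`, where the spins off `Λ` are frozen to the junk value `1` on both sides
(Friedli–Velenik 2017, §3.7.1 and Exercise 3.4). [cite: FriedliVelenik2017, §3.7.1 and Exercise 3.4] -/
def isingCorr_flip : Prop :=
  ∀ (Λ : Finset V) (β h : ℝ) (bc : BoundaryCondition V) {A : Finset V} (hA : A ⊆ Λ),
    isingCorr G Λ β (-h) bc.flip A = (-1) ^ #A * isingCorr G Λ β h bc A

/-- With free boundary condition and zero field, odd correlations vanish by spin-flip symmetry:
`⟨σ_A⟩_{Λ;β,0}^∅ = 0` for `A ⊆ Λ` of odd cardinality (Friedli–Velenik 2017, §3.7.1,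
eq. (3.33)). [cite: FriedliVelenik2017, §3.7.1  eq. (3.33] -/
def isingCorr_free_of_odd_card : Prop :=
  ∀ (Λ : Finset V) (β : ℝ) {A : Finset V} (hA : A ⊆ Λ) (hodd : Odd #A),
    isingCorr G Λ β 0 .free A = 0

end Expect

/-! ### The Ising model on the discrete torus -/

section Torus

variable (d L : ℕ) [NeZero L]

/-- The Ising model on the discrete torus `(ℤ/Lℤ)^d` (periodic boundary condition): the
finite-volume measure of `torusGraph d L` on the whole (finite) vertex set with free boundary
condition (Friedli–Velenik 2017, §3.1, periodic b.c.; Georgii 2011, Ch. 6). [cite: FriedliVelenik2017, §3.1  periodic b.c] -/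
def isingTorusMeasure (β h : ℝ) : Measure (SpinConfig (TorusSite d L)) :=
  isingMeasure (torusGraph d L) Finset.univ β h .free

/-- The torus Ising measure is a probability measure (Friedli–Velenik 2017, §3.1). [cite: FriedliVelenik2017, §3.1] -/
instance isingTorusMeasure.instIsProbabilityMeasure (β h : ℝ) :
    IsProbabilityMeasure (isingTorusMeasure d L β h) :=
  isingMeasure.instIsProbabilityMeasure _ _ _ _ _

/-- The two-point function `⟨σ_x σ_y⟩` of the torus Ising model (Friedli–Velenik 2017, §3.2). [cite: FriedliVelenik2017, §3.2] -/
def isingTorusTwoPoint (β h : ℝ) (x y : TorusSite d L) : ℝ :=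
  isingTwoPoint (torusGraph d L) Finset.univ β h .free x y

end Torus

end Literature.Probability.LatticeModels

/-! ## Appendix (literature-prover, 2026-08-14): discharge of `isingMeasure_range_glue` -/

namespace Literature.Probability.LatticeModels

open MeasureTheory

variable {V : Type*} (G : SimpleGraph V) [DecidableEq V] [G.LocallyFinite]

/-- **Discharge of `isingMeasure_range_glue`**, for every vertex type `V`: the Gibbs measure gives
mass `1` to the range of the gluing map even when that range is not measurable (uncountable `V`),
because every measurable superset `T` of it has full measure — the reference measure
`count.map (glue Λ · bc)` does not charge `Tᶜ` (its preimage is empty), the tilted measure is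
absolutely continuous with respect to it, and the measure of a set is the infimum over its
measurable supersets (`measure_eq_iInf`). (Friedli–Velenik 2017, §3.1: `μ_{Λ;β,h}^η(Ω_Λ^η) = 1`.)
[cite: FriedliVelenik2017, §3.1] -/
theorem isingMeasure_range_glue_holds : isingMeasure_range_glue G := by
  intro Λ β h bc
  refine le_antisymm prob_le_one ?_
  rw [measure_eq_iInf]
  refine le_iInf₂ fun T hT => le_iInf fun hTm => ?_
  have h0 : isingRef Λ bc Tᶜ = 0 := by
    rw [isingRef, Measure.map_apply (measurable_glue Λ bc) hTm.compl]
    convert measure_empty (μ := (Measure.count : Measure (Λ → ℤˣ)))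
    ext τ
    simp only [Set.mem_preimage, Set.mem_compl_iff, Set.mem_empty_iff_false, iff_false, not_not]
    exact hT ⟨τ, rfl⟩
  have h1 : isingMeasure G Λ β h bc Tᶜ = 0 := tilted_absolutelyContinuous _ _ h0
  exact ((prob_compl_eq_zero_iff hTm).1 h1).ge

end Literature.Probability.LatticeModels

/-! ## Appendix (literature-prover, 2026-08-14, II): discharges of `isingMeasure_apply_singleton`
and `isingMeasure_real_singleton` -/

namespace Literature.Probability.LatticeModels

open MeasureTheory

variable {V : Type*} (G : SimpleGraph V) [DecidableEq V] [G.LocallyFinite]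

/-- **The Gibbs measure of a measurable set** is the Boltzmann-weighted count of the glued
configurations it contains: `μ_{Λ;β,h}^{bc}(T) = (∑_{τ : glue τ ∈ T} w(τ)) / Z` (for every `V`;
`Measure.tilted_apply'`, the push-forward of the counting measure, and
`∫ exp (-βH) d(isingRef) = Z`). (Friedli–Velenik 2017, §3.1, Def. 3.1 and eq. (3.7).)
[cite: FriedliVelenik2017, §3.1 Def. 3.1] -/
theorem isingMeasure_apply_of_measurableSet (Λ : Finset V) (β h : ℝ) (bc : BoundaryCondition V)
    {T : Set (SpinConfig V)} (hT : MeasurableSet T) [DecidablePred (· ∈ T)] :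
    isingMeasure G Λ β h bc T =
      ENNReal.ofReal ((∑ τ : Λ → ℤˣ with glue Λ τ bc ∈ T, isingWeight G Λ β h bc τ) /
        isingPartitionFunction G Λ β h bc) := by
  classical
  have hpre : MeasurableSet ((fun τ : Λ → ℤˣ => glue Λ τ bc) ⁻¹' T) := measurable_glue Λ bc hT
  rw [isingMeasure, tilted_apply' _ _ hT, integral_exp_isingRef, isingRef,
    setLIntegral_map hT (by fun_prop) (measurable_glue Λ bc), ← lintegral_indicator hpre,
    lintegral_count, tsum_fintype, Finset.sum_div,
    ENNReal.ofReal_sum_of_nonneg (fun τ _ => div_nonneg (isingWeight_pos G Λ β h bc τ).le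
      (isingPartitionFunction_pos G Λ β h bc).le), Finset.sum_filter]
  refine Finset.sum_congr rfl fun τ _ => ?_
  by_cases hτ : glue Λ τ bc ∈ T
  · rw [if_pos hτ, Set.indicator_of_mem (show τ ∈ (fun τ : Λ → ℤˣ => glue Λ τ bc) ⁻¹' T from hτ)]
    rfl
  · rw [if_neg hτ, Set.indicator_of_notMem (show τ ∉ (fun τ : Λ → ℤˣ => glue Λ τ bc) ⁻¹' T from hτ)]

/-- **Discharge of `isingMeasure_apply_singleton`**, for every vertex type `V`: the Gibbs
probability of the single glued configuration `glue τ` is `w(τ) / Z`. When `V` is uncountable the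
singleton is not measurable; the value is pinned by two measurable sets: from above by the
`Λ`-cylinder of `τ` (which meets the range of `glue` exactly in `glue τ`, so has measure `w(τ)/Z`
by `isingMeasure_apply_of_measurableSet`), from below because every measurable superset contains
`glue τ` and hence has measure `≥ w(τ)/Z` (`measure_eq_iInf`). (Friedli–Velenik 2017, §3.1,
Def. 3.1.) [cite: FriedliVelenik2017, §3.1 Def. 3.1] -/
theorem isingMeasure_apply_singleton_holds : isingMeasure_apply_singleton G := by
  classical
  intro Λ β h bc τ
  -- the `Λ`-cylinder of `τ`: a measurable set meeting the range of `glue` exactly in `glue τ`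
  set C : Set (SpinConfig V) := (fun σ : SpinConfig V => fun x : Λ => σ x) ⁻¹' {τ} with hC
  have hres : Measurable fun σ : SpinConfig V => fun x : Λ => σ x :=
    measurable_pi_lambda _ fun x => measurable_pi_apply (x : V)
  have hCm : MeasurableSet C := hres (MeasurableSet.singleton τ)
  have hmemC : ∀ τ' : Λ → ℤˣ, glue Λ τ' bc ∈ C ↔ τ' = τ := by
    intro τ'
    simp only [hC, Set.mem_preimage, Set.mem_singleton_iff]
    constructor
    · intro h'; funext x; have := congr_fun h' x; simpa using this
    · rintro rfl; funext x; simp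
  have hfilter : (Finset.univ.filter fun τ' : Λ → ℤˣ => glue Λ τ' bc ∈ C) = {τ} := by
    ext τ'
    simp only [Finset.mem_filter, Finset.mem_univ, true_and, Finset.mem_singleton, hmemC τ']
  have hsC : (∑ τ' : Λ → ℤˣ with glue Λ τ' bc ∈ C, isingWeight G Λ β h bc τ') =
      isingWeight G Λ β h bc τ := by
    rw [hfilter, Finset.sum_singleton]
  have hμC : isingMeasure G Λ β h bc C =
      ENNReal.ofReal (isingWeight G Λ β h bc τ / isingPartitionFunction G Λ β h bc) := by
    rw [isingMeasure_apply_of_measurableSet G Λ β h bc hCm, hsC]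
  have hsum : ∀ (T : Set (SpinConfig V)) [DecidablePred (· ∈ T)], glue Λ τ bc ∈ T →
      isingWeight G Λ β h bc τ ≤
        ∑ τ' : Λ → ℤˣ with glue Λ τ' bc ∈ T, isingWeight G Λ β h bc τ' := by
    intro T _ hT
    exact Finset.single_le_sum (f := fun τ' => isingWeight G Λ β h bc τ')
      (fun τ' _ => (isingWeight_pos G Λ β h bc τ').le) (Finset.mem_filter.2 ⟨Finset.mem_univ _, hT⟩)
  apply le_antisymm
  · -- from above, by the cylinder
    rw [← hμC]
    exact measure_mono fun σ hσ => by rw [Set.mem_singleton_iff.1 hσ]; exact (hmemC τ).2 rfl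
  · -- from below, by every measurable superset
    rw [measure_eq_iInf]
    refine le_iInf₂ fun T hT => le_iInf fun hTm => ?_
    rw [isingMeasure_apply_of_measurableSet G Λ β h bc hTm]
    exact ENNReal.ofReal_le_ofReal (div_le_div_of_nonneg_right (hsum T (hT rfl))
      (isingPartitionFunction_pos G Λ β h bc).le)

/-- **Discharge of `isingMeasure_real_singleton`** (the interim proof preserved in the file, now
unconditional via `isingMeasure_apply_singleton_holds`). (Friedli–Velenik 2017, §3.1.)
[cite: FriedliVelenik2017, §3.1] -/
theorem isingMeasure_real_singleton_holds : isingMeasure_real_singleton G := by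
  intro Λ β h bc τ
  rw [Measure.real, isingMeasure_apply_singleton_holds, ENNReal.toReal_ofReal]
  exact div_nonneg (isingWeight_pos G Λ β h bc τ).le (isingPartitionFunction_pos G Λ β h bc).le

end Literature.Probability.LatticeModels

/-! ## Appendix (literature-prover, 2026-08-14, III): spin-flip symmetry — discharges of
`isingCorr_fixed_flip` and `isingCorr_flip` (`isingCorr_free_of_odd_card` is discharged
downstream, `PlusFreeComparison.isingCorr_free_of_odd_card_holds`) -/

namespace Literature.Probability.LatticeModels

open MeasureTheory

variable {V : Type*} (G : SimpleGraph V) [DecidableEq V] [G.LocallyFinite]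

omit [DecidableEq V] [G.LocallyFinite] in
/-- `σ_x(-σ) = -σ_x(σ)` (Friedli–Velenik 2017, §3.7.1). [cite: FriedliVelenik2017, §3.7.1] -/
theorem spinAt_neg (x : V) (σ : SpinConfig V) : spinAt x (-σ) = -spinAt x σ := by
  simp [spinAt, Units.val_neg]

omit [DecidableEq V] [G.LocallyFinite] in
/-- Inside `Λ`, gluing the flipped finite configuration with the flipped boundary condition is
the flip of the glued configuration (Friedli–Velenik 2017, §3.7.1). [cite: FriedliVelenik2017, §3.7.1] -/
theorem spinAt_glue_neg_flip_of_mem (Λ : Finset V) (τ : Λ → ℤˣ) (bc : BoundaryCondition V)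
    {x : V} (hx : x ∈ Λ) : spinAt x (glue Λ (-τ) bc.flip) = -spinAt x (glue Λ τ bc) := by
  simp [spinAt, hx, Units.val_neg]

/-- **The Hamiltonian is invariant under the global spin flip** combined with `h ↦ -h` and
`bc ↦ bc.flip`: `H_{Λ;-h}^{bc.flip}(glue (-τ)) = H_{Λ;h}^{bc}(glue τ)` (for the free boundary
condition the interacting edges lie inside `Λ`, where the two glued configurations are opposite)
(Friedli–Velenik 2017, §3.7.1). [cite: FriedliVelenik2017, §3.7.1] -/
theorem isingHamiltonian_glue_neg_flip (Λ : Finset V) (h : ℝ) (bc : BoundaryCondition V)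
    (τ : Λ → ℤˣ) :
    isingHamiltonian G Λ (-h) bc.flip (glue Λ (-τ) bc.flip) =
      isingHamiltonian G Λ h bc (glue Λ τ bc) := by
  have hfield : -h * ∑ x ∈ Λ, spinAt x (glue Λ (-τ) bc.flip) =
      h * ∑ x ∈ Λ, spinAt x (glue Λ τ bc) := by
    rw [Finset.mul_sum, Finset.mul_sum]
    refine Finset.sum_congr rfl fun x hx => ?_
    rw [spinAt_glue_neg_flip_of_mem Λ τ bc hx]
    ring
  have hbond : ∀ e ∈ interactionEdges G Λ bc.flip,
      bondSpin (glue Λ (-τ) bc.flip) e = bondSpin (glue Λ τ bc) e := by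
    intro e he
    cases bc with
    | free =>
      rw [BoundaryCondition.flip_free, interactionEdges_free, mem_edgesIn_iff] at he
      induction e using Sym2.ind with
      | _ x y =>
        have hx : x ∈ Λ := he.2 x (Sym2.mem_mk_left x y)
        have hy : y ∈ Λ := he.2 y (Sym2.mem_mk_right x y)
        rw [bondSpin_mk, bondSpin_mk, ← BoundaryCondition.flip_free,
          spinAt_glue_neg_flip_of_mem Λ τ _ hx, spinAt_glue_neg_flip_of_mem Λ τ _ hy]
        ring
    | fixed η =>
      induction e using Sym2.ind with
      | _ x y =>
        rw [bondSpin_mk, bondSpin_mk, BoundaryCondition.flip_fixed, glue_neg_fixed,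
          spinAt_neg, spinAt_neg]
        ring
  have hedges : interactionEdges G Λ bc.flip = interactionEdges G Λ bc := by
    cases bc <;> rfl
  unfold isingHamiltonian
  rw [hfield, ← hedges, Finset.sum_congr rfl hbond]

/-- The Boltzmann weight is invariant under the combined flip:
`w_{Λ;β,-h}^{bc.flip}(-τ) = w_{Λ;β,h}^{bc}(τ)` (Friedli–Velenik 2017, §3.7.1). [cite: FriedliVelenik2017, §3.7.1] -/
theorem isingWeight_neg_flip (Λ : Finset V) (β h : ℝ) (bc : BoundaryCondition V) (τ : Λ → ℤˣ) :
    isingWeight G Λ β (-h) bc.flip (-τ) = isingWeight G Λ β h bc τ := by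
  rw [isingWeight, isingWeight, isingHamiltonian_glue_neg_flip]

/-- The partition function is invariant under the combined flip:
`Z_{Λ;β,-h}^{bc.flip} = Z_{Λ;β,h}^{bc}` (Friedli–Velenik 2017, §3.7.1). [cite: FriedliVelenik2017, §3.7.1] -/
theorem isingPartitionFunction_flip (Λ : Finset V) (β h : ℝ) (bc : BoundaryCondition V) :
    isingPartitionFunction G Λ β (-h) bc.flip = isingPartitionFunction G Λ β h bc := by
  unfold isingPartitionFunction
  refine Fintype.sum_equiv (Equiv.neg _) _ _ fun τ => ?_
  rw [Equiv.neg_apply, ← isingWeight_neg_flip G Λ β h bc (-τ), neg_neg]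

omit [DecidableEq V] [G.LocallyFinite] in
/-- For `A ⊆ Λ`, the spin product picks up `(-1)^{|A|}` under the combined flip:
`σ_A(glue (-τ) bc.flip) = (-1)^{|A|} σ_A(glue τ bc)` (Friedli–Velenik 2017, §3.7.1). [cite: FriedliVelenik2017, §3.7.1] -/
theorem spinProduct_glue_neg_flip {Λ A : Finset V} (hA : A ⊆ Λ) (τ : Λ → ℤˣ)
    (bc : BoundaryCondition V) :
    spinProduct A (glue Λ (-τ) bc.flip) = (-1) ^ A.card * spinProduct A (glue Λ τ bc) := by
  unfold spinProduct
  rw [Finset.prod_congr rfl fun x hx => spinAt_glue_neg_flip_of_mem Λ τ bc (hA hx),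
    Finset.prod_neg]

/-- **Spin-flip symmetry for `A ⊆ Λ` and any boundary condition**: the common computation
behind the two discharges below,
`⟨σ_A⟩_{Λ;β,-h}^{bc.flip} = (-1)^{|A|} ⟨σ_A⟩_{Λ;β,h}^{bc}` (change of variables `τ ↦ -τ` in the
finite Boltzmann sum `integral_isingMeasure`) (Friedli–Velenik 2017, §3.7.1 and Exercise 3.4). [cite: FriedliVelenik2017, §3.7.1 and Exercise 3.4] -/
theorem isingCorr_flip_of_subset (Λ : Finset V) (β h : ℝ) (bc : BoundaryCondition V)
    {A : Finset V} (hA : A ⊆ Λ) :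
    isingCorr G Λ β (-h) bc.flip A = (-1) ^ A.card * isingCorr G Λ β h bc A := by
  rw [isingCorr, isingCorr, isingExpect, isingExpect,
    integral_isingMeasure G Λ β (-h) bc.flip (measurable_spinProduct A),
    integral_isingMeasure G Λ β h bc (measurable_spinProduct A), isingPartitionFunction_flip,
    mul_div_assoc', Finset.mul_sum]
  congr 1
  refine Fintype.sum_equiv (Equiv.neg _) _ _ fun τ => ?_
  rw [Equiv.neg_apply, ← isingWeight_neg_flip G Λ β h bc (-τ), neg_neg,
    ← neg_neg τ, spinProduct_glue_neg_flip hA (-τ) bc, neg_neg]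
  ring

/-- **Discharge of `isingCorr_flip`**: `⟨σ_A⟩_{Λ;β,-h}^{bc.flip} = (-1)^{|A|} ⟨σ_A⟩_{Λ;β,h}^{bc}`
for `A ⊆ Λ` (Friedli–Velenik 2017, §3.7.1 and Exercise 3.4). [cite: FriedliVelenik2017, §3.7.1 and Exercise 3.4] -/
theorem isingCorr_flip_holds : isingCorr_flip G := fun Λ β h bc _ hA =>
  isingCorr_flip_of_subset G Λ β h bc hA

/-- **Discharge of `isingCorr_fixed_flip`**: for a fixed boundary condition the flip identity
holds for every finite `A` (outside `Λ` both glued configurations are the flipped boundary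
spins, `glue_neg_fixed`) (Friedli–Velenik 2017, §3.7.1 and Exercise 3.4). [cite: FriedliVelenik2017, §3.7.1 and Exercise 3.4] -/
theorem isingCorr_fixed_flip_holds : isingCorr_fixed_flip G := by
  intro Λ β h η A
  rw [isingCorr, isingCorr, isingExpect, isingExpect, ← BoundaryCondition.flip_fixed,
    integral_isingMeasure G Λ β (-h) _ (measurable_spinProduct A),
    integral_isingMeasure G Λ β h _ (measurable_spinProduct A), isingPartitionFunction_flip,
    mul_div_assoc', Finset.mul_sum]
  congr 1
  refine Fintype.sum_equiv (Equiv.neg _) _ _ fun τ => ?_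
  rw [Equiv.neg_apply, ← isingWeight_neg_flip G Λ β h _ (-τ), neg_neg,
    BoundaryCondition.flip_fixed, ← neg_neg τ, glue_neg_fixed, neg_neg, spinProduct_neg]
  ring

end Literature.Probability.LatticeModels
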